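import Mathlib
import HarnessLib
import HarnessLib.Audit
import Summits.Parity.Statement
import Literature.Barriers.Parity.SiegelZeroDichotomy
import Literature.NumberTheory.Sieve.PrimeGapLimitPoints

/-!
Route: GapLimitPointSplit

DORMANT since 2026-09-04T15:39:44Z (reconciler: no traction for 5 d (last activity statement-checked at 2026-08-30T14:14:31Z); parked, not closed — `ledger route dormant route-Parity-GapLimitPointSplit --off` to reactivate) — unstaffed, not closed; items shared with open routes are served there. `ledger route dormant <id> --off` reactivates.

# Route GapLimitPointSplit — GHL ⟸ the record's Siegel/fixed leaves ∧ the three-point property of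
the prime-gap limit set ∧ its lift to the uniform halves

decomp-parity (D-0178/D-0179) lens-2 g7 node «GapLimitPointSplit» (RESIDUAL mode): an ALTERNATIVE
DECOMPOSITION of the record route
route-Parity-SiegelSpectrumSplit beneath its two UNIFORM (moving-shift) residual leaves UU =
stmt-Parity-26853 and UL = stmt-Parity-26864 jointly,
on an axis disjoint from every cell node: the set 𝓛 = primeGapLimitSet of limit points of the
normalized consecutive prime gaps (p_(n+1) − p_n)/log p_n.
It suffices to show X = Q ∧ FixedUpper ∧ FixedLower ∧ ThreePoint ∧ GapLift, where Q (25148),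
FixedUpper (26852), FixedLower (26863) are the record's
items VERBATIM (shared by signature), ThreePoint := HasPointProperty primeGapLimitSet 3 («among any
three reals β₀ ≤ β₁ ≤ β₂ some difference is a limit
point of normalized prime gaps»; record k = 4, Merikoski 2020; k = 2 is Erdős's conjecture [0,∞) ⊆
𝓛) and GapLift := ThreePoint → (UU ∧ UL) (the record's
uniform residuals weakened by exactly this hypothesis; declared residual). Kernel
(HOME/decomp-parity-lens-2/g7/GapLimitPointSplit.lean, rc 0, 0 sorry):
necessity threePoint_of_ghl (tree theorem Gallagher.Ici_subset_primeGapLimitSet_of_GHL by name),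
threePoint_of_leaves, node_iff : (UU ∧ UL) ↔ (ThreePoint ∧
GapLift) given Q, FU, FL; closes with 5/5 binders by pure logic. SITING (critic row 67 P4): beneath
UU ∧ UL and NOT beneath FU ∧ FL, because
Gallagher's necessity consumes the d = 1 face of GHL with shifts ≤ λ·log N, i.e. N-DEPENDENT systems
(affLinSize Ψ N ≤ L·N with N₀ chosen before Ψ) — covered
by the uniform leaves only (the fixed leaves quantify Ψ before N₀; kernel
not_hasPointProperty_three_singleton_zero: fixed patterns give only 0 ∈ 𝓛). Hub prior art
on 𝓛 (cited, not used): parity-ideate-p4's FRONTIER Theorems PrimeGapTorusCap* /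
PrimeGapInitialSegment* (consequences of k = 4). Critic CLEARED 2026-08-30T08:58:45Z
(CRITIC-LEDGER row 67) with precisions P1–P4 applied below.
Lean: `(∃ η₀ : ℝ, ∃ q₀ : ℕ, ∀ (q : ℕ) [NeZero q] (χ : DirichletCharacter ℂ q) (η : ℝ), q₀ ≤ q →
Literature.Barriers.Parity.IsSiegelZero χ η → η < η₀) ∧ (∀ (d t : ℕ), 1 ≤ d → 1 ≤ t → ∀ Ψ : Fin t →
Literature.NumberTheory.Sieve.AffLinForm d, Literature.NumberTheory.Sieve.IsNondegenerateSystem Ψ →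
∀ ε : ℝ, 0 < ε → ∃ N₀ : ℕ, ∀ N : ℕ, N₀ ≤ N → ∀ K : Set (Fin d → ℝ), Convex ℝ K → K ⊆
Literature.NumberTheory.Sieve.realBox d N → Literature.NumberTheory.Sieve.vonMangoldtSum Ψ K N -
Literature.NumberTheory.Sieve.archFactor Ψ K * Literature.NumberTheory.Sieve.singularProduct Ψ ≤ ε *
(N : ℝ) ^ d) ∧ (∀ (d t : ℕ), 1 ≤ d → 1 ≤ t → ∀ Ψ : Fin t → Literature.NumberTheory.Sieve.AffLinForm
d, Literature.NumberTheory.Sieve.IsNondegenerateSystem Ψ → ∀ ε : ℝ, 0 < ε → ∃ N₀ : ℕ, ∀ N : ℕ, N₀ ≤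
N → ∀ K : Set (Fin d → ℝ), Convex ℝ K → K ⊆ Literature.NumberTheory.Sieve.realBox d N →
Literature.NumberTheory.Sieve.archFactor Ψ K * Literature.NumberTheory.Sieve.singularProduct Ψ -
Literature.NumberTheory.Sieve.vonMangoldtSum Ψ K N ≤ ε * (N : ℝ) ^ d) ∧
(Literature.NumberTheory.Sieve.HasPointProperty Literature.NumberTheory.Sieve.primeGapLimitSet 3) ∧
(Literature.NumberTheory.Sieve.HasPointProperty Literature.NumberTheory.Sieve.primeGapLimitSet 3 →
(((∃ η₀ : ℝ, ∃ q₀ : ℕ, ∀ (q : ℕ) [NeZero q] (χ : DirichletCharacter ℂ q) (η : ℝ), q₀ ≤ q →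
Literature.Barriers.Parity.IsSiegelZero χ η → η < η₀) → (∀ (d t : ℕ), 1 ≤ d → 1 ≤ t → ∀ Ψ : Fin t →
Literature.NumberTheory.Sieve.AffLinForm d, Literature.NumberTheory.Sieve.IsNondegenerateSystem Ψ →
∀ ε : ℝ, 0 < ε → ∃ N₀ : ℕ, ∀ N : ℕ, N₀ ≤ N → ∀ K : Set (Fin d → ℝ), Convex ℝ K → K ⊆
Literature.NumberTheory.Sieve.realBox d N → Literature.NumberTheory.Sieve.vonMangoldtSum Ψ K N -
Literature.NumberTheory.Sieve.archFactor Ψ K * Literature.NumberTheory.Sieve.singularProduct Ψ ≤ ε *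
(N : ℝ) ^ d) → ∀ (d t L : ℕ), 1 ≤ d → 1 ≤ t → ∀ ε : ℝ, 0 < ε → ∃ N₀ : ℕ, ∀ N : ℕ, N₀ ≤ N → ∀ Ψ : Fin
t → Literature.NumberTheory.Sieve.AffLinForm d, Literature.NumberTheory.Sieve.IsNondegenerateSystem
Ψ → Literature.NumberTheory.Sieve.affLinSize Ψ N ≤ L → ∀ K : Set (Fin d → ℝ), Convex ℝ K → K ⊆
Literature.NumberTheory.Sieve.realBox d N → Literature.NumberTheory.Sieve.vonMangoldtSum Ψ K N -
Literature.NumberTheory.Sieve.archFactor Ψ K * Literature.NumberTheory.Sieve.singularProduct Ψ ≤ ε *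
(N : ℝ) ^ d) ∧ ((∃ η₀ : ℝ, ∃ q₀ : ℕ, ∀ (q : ℕ) [NeZero q] (χ : DirichletCharacter ℂ q) (η : ℝ), q₀ ≤
q → Literature.Barriers.Parity.IsSiegelZero χ η → η < η₀) → (∀ (d t : ℕ), 1 ≤ d → 1 ≤ t → ∀ Ψ : Fin
t → Literature.NumberTheory.Sieve.AffLinForm d, Literature.NumberTheory.Sieve.IsNondegenerateSystem
Ψ → ∀ ε : ℝ, 0 < ε → ∃ N₀ : ℕ, ∀ N : ℕ, N₀ ≤ N → ∀ K : Set (Fin d → ℝ), Convex ℝ K → K ⊆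
Literature.NumberTheory.Sieve.realBox d N → Literature.NumberTheory.Sieve.archFactor Ψ K *
Literature.NumberTheory.Sieve.singularProduct Ψ - Literature.NumberTheory.Sieve.vonMangoldtSum Ψ K N
≤ ε * (N : ℝ) ^ d) → ∀ (d t L : ℕ), 1 ≤ d → 1 ≤ t → ∀ ε : ℝ, 0 < ε → ∃ N₀ : ℕ, ∀ N : ℕ, N₀ ≤ N → ∀ Ψ
: Fin t → Literature.NumberTheory.Sieve.AffLinForm d,
Literature.NumberTheory.Sieve.IsNondegenerateSystem Ψ → Literature.NumberTheory.Sieve.affLinSize Ψ N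
≤ L → ∀ K : Set (Fin d → ℝ), Convex ℝ K → K ⊆ Literature.NumberTheory.Sieve.realBox d N →
Literature.NumberTheory.Sieve.archFactor Ψ K * Literature.NumberTheory.Sieve.singularProduct Ψ -
Literature.NumberTheory.Sieve.vonMangoldtSum Ψ K N ≤ ε * (N : ℝ) ^ d)))`

## Assembly
Pure logic plus |a − b| ≤ c ⟺ (a − b ≤ c ∧ b − a ≤ c): hR hN is the pair (UU, UL); hUU hQ hFU is the
uniform upper half, hUL hQ hFL the uniform lower
half, and the two halves with N₀ := max give GHL (`closes` in glue.lean, 5/5 binders consumed).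
Exactness in the cell file: node_iff ((UU ∧ UL) ↔ (ThreePoint
∧ GapLift) given Q, FU, FL) and conjunct_iff (GHL ↔ X MODULO the record's own necessity hypothesis
GHL ⟹ Q, Matomäki–Merikoski 2023 — the record carries
the same caveat).

Rationale: WHY THIS LINE. Lens 2 «special vs generic» applied to the SCALE of a consecutive prime gap: the
special scales β ∈ {0, ∞} of (p_(n+1) − p_n)/log p_n are exactly the
ones settled by extra structure (0 ∈ 𝓛 from dense admissible tuples, GoldstonPintzYildirim2009 /
Maynard2015SmallGaps, tree theorem
zero_mem_primeGapLimitSet; ∞ from Erdős–Rankin coverings), while a generic scale β ∈ (0,∞) has no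
individual handle («no other explicit numbers are known to
lie in 𝓛», arXiv:2207.03463 §3) and is reached only CLASS-wise by the pigeonhole dial k of
BanksFreibergMaynard2016 (k = 9, arXiv:1404.5094 Thm 1.1), Pintz
(k = 5, arXiv:1510.04577) and Merikoski2020GapLimitPoints (k = 4, arXiv:1811.03008 Thm 1):
Maynard–Tao sieve weights uniform over tuples of diameter ≍ log N, a
modified Erdős–Rankin construction forcing consecutiveness, and a PAIR UPPER-BOUND sieve (Selberg, A
= 4; Chen, A = 3.99) for anti-concentration; the printed
rule «A < k ⟹ k points» (arXiv:1811.03008 Remark 2) makes k = 3 the next rung with threshold A < 3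
strictly above the parity floor A = 2 (Bombieri's
asymptotic sieve), so the credited piece is attackable by sharper weighted pair sieves or by level
of distribution beyond 1/2 for smooth moduli, and it is
NECESSARY for GHL through Gallagher1976 (uniform HL on shifts ≤ λ log N ⟹ Poisson gaps ⟹ [0,∞) ⊆ 𝓛,
all tree theorems). Imported: the Maynard–Tao sieve /
bounded-gaps technology and Gallagher's Poisson computation (probabilistic number theory); versus
prior routes and the negatives index: no Parity route,
card or refuted statement mentions 𝓛, the k-point property or Erdős's gap conjecture (ledger idea
list / negatives: 0 rows; tree: only Literature files and
parity-ideate-p4's FRONTIER Theorems PrimeGapTorusCap*/PrimeGapInitialSegment*, consequences of k =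
4 with «nothing here bears on the parity problem»);
every cell notch so far (2-of-3, DHL thresholds, LPF of p+2, Artin, windows N^θ, Goldbach faces,
scale averages) is a statement about HL COUNTS at fixed
or polynomially large shifts, this one is about consecutive gaps at shifts ≍ β log N and neither
implies the other.

RANKED CRUXES. #2 ThreePoint (crux) — the THREE-POINT PROPERTY of 𝓛 = primeGapLimitSet: for all
reals β₀ ≤ β₁ ≤ β₂ at least one of β₁ − β₀, β₂ − β₀, β₂ − β₁ is a limit point of (p_(n+1) − p_n)/log
p_n (literal k = 3; record k = 4 = Merikoski 2020 Thm 1 = tree named fact Merikoski2020_theorem1; k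
= 2 ⟺ Erdős). NECESSARY (kernel threePoint_of_ghl = Gallagher.Ici_subset_primeGapLimitSet_of_GHL + 2
≤ 3; threePoint_of_leaves; threePoint_of_parity) and STRICTLY WEAKER (constrains only the closed set
𝓛: kernel content «∀ T ≥ 0, T ∈ 𝓛 ∨ 2T ∈ 𝓛»; Poisson gaps / Erdős sit strictly below uniform HL in
print). ATTACKABLE with printed method floor (arXiv:1811.03008 §1.3 + Remark 2): Maynard-weighted
pair upper bound with constant A < 3 suffices (A_rec = 3.99 by Chen's sieve; parity floor A = 2);
named inputs: sharper weighted pair upper-bound sieves (switching / Fouvry–Grupp–Wu iteration),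
level > 1/2 for the modified BV over multiples of a smooth W (BFM Thm 4.2; MPZ-type), EH-level
inputs (conditional; EH ⟹ k = 3 not in print). TAGS (critic row 67): WEAKER by evidence +
unconditional ladder ONLY — no model witness in print (no hypothesis class short of HL-type input
decides k = 3; EH/GEH ⟹ k = 3 NOT in print); credit in 𝓛/A-currency ONLY (k: 4 → 3; A: 3.99 → < 3; ≡
measure density 1/3 → 1/2), rung 0 toward GHL, never sieve-dimension or HL-distance credit; NO
PROVER TIME (P1: A < 3 is beyond print, Merikoski names k = 3 open) — hands only:
Theorems/GapLimitPointSplitNecessity.lean --supports this item (threePoint_of_ghl /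
threePoint_of_leaves / node_iff / dial rungs by name); re-dials (k = 2 Erdős, «1 ∈ 𝓛 ∨ 2 ∈ 𝓛», «T ∨
2T», measure forms, 𝓛 with ∞, other normalisations) = VARIANT, never a second node (P3);
SIEGEL-INERT. [difficulty: open-problem] (why it might fail: Kernel-implied by GHL, so false only
with Parity; live risk = the pair constant: A must drop from 3.99 to below 3 at level 1/2 (25%),
more than the twin-constant ladder 4 → 3.29956 achieved in 40 years; parity blocks only A < 2.)
[Merikoski2020GapLimitPoints, BanksFreibergMaynard2016, arXiv:1811.03008, arXiv:1404.5094,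
arXiv:1510.04577, Gallagher1976, arXiv:2207.03463]
#3 GapLift (crux) — ThreePoint → (UniformUpperGivenFixed ∧ UniformLowerGivenFixed) — the record's
two uniform residual leaves stmt-Parity-26853 / 26864 (texts verbatim: Q → fixed half → uniform half
of GT Conj. 1.2, upper resp. lower) weakened by exactly the face hypothesis ThreePoint. DECLARED
RESIDUAL (all binary / moving-shift content of GHL given Q and the fixed patterns; zero credit;
never staffed — NO prover time (critic row 67 P1); TERMINAL on this dial: the next rung k = 2 =
Erdős is parity-blocked); trivial branch gapLift_of_not_threePoint, contraction
gapLift_iff_of_threePoint (when ThreePoint lands the route contracts onto the record). [deps: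
ThreePoint] [difficulty: open-problem] (why it might fail: Kernel-implied by GHL (its consequent is
UU ∧ UL); as an implication it must produce binary Goldbach / every moving-shift HL bound from a
pigeonhole fact about three gap scales — head-on CircleMethodBinary / TrueComplexityBinary; no
mechanism in print.) [GreenTao2010, MatomakiRadziwillTao2019, MatomakiMerikoski2023, Gallagher1976,
Literature.Barriers.Parity.CircleMethodBinary, Literature.Barriers.Parity.TrueComplexityBinary]
#4 BoundedSiegelZeroQuality (crux) — the record's Siegel crux stmt-Parity-25148 verbatim
(exceptional zeros have bounded quality η); shared by signature, filing fields = the record's.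
[difficulty: open-problem] (why it might fail: it is the Landau–Siegel problem: no unconditional
bound on η is known (Siegel's theorem is ineffective); a genuine open problem, not a lemma.)
[HeathBrown1983PrimeTwins, MatomakiMerikoski2023, TaoTeravainen2021]
#5 FixedUpper (crux) — the record's item stmt-Parity-26852 verbatim (upper half of GT Conj. 1.2 for
every fixed non-degenerate system); shared by signature, filing fields = the record's. [difficulty:
open-problem] (why it might fail: As a target it contains the upper prime k-tuples bound with
constant 1+ε for every fixed tuple: Type-I sieves stop at factor 2 (Selberg parity,
LinearSieveOptimality); record 3.2996 for twins; open even under GRH.) [GreenTao2010,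
HardyLittlewood1923, Selberg1949, Literature.Barriers.Parity.SelbergParity,
Literature.Barriers.Parity.LinearSieveOptimality]
#6 FixedLower (crux) — the record's item stmt-Parity-26863 verbatim (lower half of GT Conj. 1.2 for
every fixed non-degenerate system: twin primes, prime k-tuples with the HL constant); shared by
signature, filing fields = the record's. [difficulty: open-problem] (why it might fail: As a target
it contains twin primes and every prime k-tuple with the HL constant: parity (Selberg, Bombieri,
Ford–Maynard; PrimePairParity even under GEH) blocks all Type-I/II routes; bounded gaps name no
pattern.) [GreenTao2010, HardyLittlewood1923, HeathBrown1983PrimeTwins, Maynard2015SmallGaps,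
Literature.Barriers.Parity.PrimePairParity]

TWO-LAYER PLAN. None at open. ThreePoint is a literal terminal notch on the k-dial (k = 2 = Erdős is
parity-blocked, arXiv:1811.03008 Remark 2) and is never split by
k, by measure density (1/3 → 1/2 comes with it, Merikoski Prop. 4) or by normalizing function
(Baker–Freiberg variants are the same notch). The only foreseen
split is the printed one: ThreePoint ⇐ PairBoundBelowThree («(pairsout) with some A < 3 for
Maynard–Tao weights at level 1/2 over multiples of smooth W») →
(BFM–Merikoski pigeonhole: PairBoundBelowThree ⟹ ThreePoint) — filed, if ever, as the BC3 skeleton's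
stubs, not as items. GapLift is a residual and is
never split. If ThreePoint lands, GapLift ≡ UU ∧ UL (costume) and the route is superseded by the
record (declared).

KILL CRITERIA. A refutation of ThreePoint refutes GHL and Parity (kernel necessity
threePoint_of_ghl): route, sub-problem and summit close refuted together. A landed
unconditional theorem «𝓛 has the 3-point property» closes ThreePoint and collapses the route onto
the record (GapLift becomes UU ∧ UL: superseded,
declared). A tribunal finding that ThreePoint is a RUNG of an adjacent programme rather than a piece
(T13 drift) retires the route to the census; the kernel
theorems threePoint_of_ghl / node_iff survive as support landings.

NOT DECOMPOSED YET. ThreePoint is not decomposed into «pair bound A < 3» ∧ «A < 3 ⟹ 3 points» at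
open (the second is BFM §4–6 + Merikoski §5, referee-grade but long; the
first is the whole difficulty). The intermediate rungs EmptyWindowPoisson (Gallagher's k = 0 law)
and ErdosGapConjecture ([0,∞) ⊆ 𝓛) are NOT filed (both
are parity-class: A < 2); the record rung k = 4 is a named fact, not an item; the measure form μ(𝓛 ∩
[0,T]) ≥ T/2 and the explicit form «1 ∈ 𝓛 ∨ 2 ∈ 𝓛» are
kernel corollaries of ThreePoint, not items. No other normalization, no ∞-side statement, no
Cramér/Poisson distribution statement is filed.

CHEAPEST FALSIFIER. (i) Theorem test (T8): is the 3-point property already a theorem? No — Merikoski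
2020 Remark 2 names it as what A < 3 would give; Granville 2022
(arXiv:2207.03463 §3: «at least 1/3 … no other explicit numbers known»); 2025 citing works
(arXiv:2406.04174, arXiv:2402.00748) still cite k = 4; galaxy
--star all «normalized prime gaps|limit points of normalized»: Pintz–Rassias (eds.) 2018, Pintz 2014
— nothing newer. (ii) Vacuity: HasPointProperty B k is
FALSE for k ≤ 1 and for B = {0} at k = 3 (kernel), TRUE for B ⊇ [0,∞); ThreePoint is neither
trivially true (𝓛 is not known to contain any explicit positive
real) nor trivially false (k = 4 holds). (iii) C → S probes: ThreePoint ⇏ GHL cheaply (BC2/BC7 P5 to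
run at filing); GapLift ⇏ GHL cheaply.

NUMBERS. k-point record: 9 (BFM 2016) → 5 (Pintz 2016) → 4 (Merikoski 2020); notch 3; Erdős 2.
Measure density of 𝓛 ∩ [0,T]: 1/8 → 1/4 → 1/3 (asymptotic, ineffective
o(1)); T/3 for all T (Merikoski Cor. 2); k = 3 would give 1/2. Pair constant A in (pairsout): 4
(Selberg, BFM) → 3.99 (Chen, Merikoski); needed < 3; parity
floor 2. Classical twin upper-bound constant for comparison: 4 → 3.5 (BFI 1986) → 3.418
(Fouvry–Grupp) → 3.3996 (Wu 2004) → 3.29956; 2 under EH. Explicit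
members of 𝓛 known: 0 (GPY/Maynard) and ∞ (Westzynthius) only; gaps between limit points bounded by
an absolute ineffective constant (Merikoski Cor. 3).

DEFINITION REQUESTS. None: every item is stated over existing declarations
(Literature.NumberTheory.Sieve.{HasPointProperty, primeGapLimitSet, AffLinForm,
IsNondegenerateSystem,
affLinSize, realBox, vonMangoldtSum, archFactor, singularProduct};
Literature.Barriers.Parity.IsSiegelZero; DirichletCharacter).

Novelty: Searches (2026-08-30): rg 'primeGapLimitSet|HasPointProperty|Merikoski2020' over lean/Summits and
lean/Literature (hits: 4 Literature files + parity-ideate-p4's Theorems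
PrimeGapTorusCap*/PrimeGapInitialSegment* only; no Theses file); rg over the cell HOME (STATUS, TREE
v4.20, CRITIC-LEDGER, census v1–v7): 0 nodes on 𝓛; ledger idea list --problem Parity --status all |
grep limit/gap/poisson (ClassVarianceLadder variance card, falsified vernier card, declined
gap-reformulation cards — none on 𝓛); ledger negatives --problem Parity: 0 rows on gaps/limit
points; lit search "Merikoski \"limit points\" normalized prime gaps" (7 local docs:
arXiv:1811.03008, 2306.12855, 2207.03463, 2409.12819, 2406.04174, 2402.00748, 2604.15042 — none
improves k = 4); lit read arXiv:1811.03008 / 1404.5094 / 2207.03463 with grep; lit vsearch prose (no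
relevant hit); lit galaxy search "normalized prime gaps|limit points of normalized|sequence of
normalized prime" --star all (panama:373138168741893 Pintz–Rassias eds. 2018;
pdf:-7415298198939735120 Pintz; pdf:-4779781982134597260 Polymath retrospective).
Nearest prior art found: Merikoski2020GapLimitPoints (arXiv:1811.03008: k = 4 and Remark 2 naming k
= 3 / A < 3 as the next step), BanksFreibergMaynard2016 (arXiv:1404.5094: the method), Gallagher1976
(uniform HL ⟹ Poisson: the necessity), parity-ideate-p4's FRONTIER formalisation of consequences of
k = 4 in the tree; on the hub: SiegelSpectrumSplit (record), AbelianShadowSplit / TelescopingWindows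
/ Go  [refs: 1811.03008, 1404.5094, BanksFreibergMaynard2016, Gallagher1976]

Barriers (technique_class: decomposition, gap-limit-points, maynard-sieve): - technique_class: decomposition, gap-limit-points, maynard-sieve
- Literature.Barriers.Parity.SelbergParityBarrier: ThreePoint is INSIDE the technique class
(upper-bound sieve constants for prime pairs) but ABOVE the barrier's floor — parity forbids A < 2
(Merikoski Remark 2, Bombieri's asymptotic sieve), the notch needs only A < 3; GapLift is inside
head-on (residual, declared).
- Literature.Barriers.Parity.LinearSieveOptimality: same placement — the linear-sieve constant 2/θ
at level θ = 1/2 gives A = 4; the bet is Chen-type switching / weighted-sieve iteration and level >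
1/2 for smooth moduli, both of which already moved A off 4 (3.99) and the twin constant to 3.29956;
the notch does not require beating F, f optimality, only combining inputs outside the pure linear
sieve.
- Literature.Barriers.Parity.PrimePairParity: not engaged by ThreePoint — no lower bound for a
prime-pair count is ever asserted (Maynard's sieve lower-bounds «≥ 2 primes among K shifts»,
parity-compatible; pairs are only upper-bounded); GapLift inside head-on (residual).
- Literature.Barriers.Parity.MaynardFunctionalCeiling: not binding — the k-point argument takes the
tuple size K as large as needed (M_K → ∞); the binding functional is the pair constant A, not M_k.
- Literature.Barriers.Parity.FordMaynardMinimalTypeII: not engaged as typed (no claim to produce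
primes in a single sifted sequence from Type I/II data beyond Maynard's theorem, which is used as a
theorem).
- Literature.Barriers.Parity.Equi

History (route lifecycle, newest last):
- 2026-09-04T15:39:44Z · DORMANT — reconciler: no traction for 5 d (last activity statement-checked at 2026-08-30T14:14:31Z); parked, not closed — `ledger route dormant route-Parity-GapLimitPoint (operator:999:3202237)

sub-problem: GeneralizedHardyLittlewood · status: dormant · opened planner-decomp-parity-lens-2-g7-0 2026-08-30T09:14:47Z · rev 0 · ledger route-Parity-GapLimitPointSplit
GENERATED by the gate from the ledger (D-0016/17). Provers cite these decls: `theorem foo : Summit.Parity.GeneralizedHardyLittlewood.Theses.GapLimitPointSplit.<Decl> := …` in Summits/Parity/GeneralizedHardyLittlewood/Theorems/<Name>.lean.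
-/

namespace Summit.Parity.GeneralizedHardyLittlewood.Theses.GapLimitPointSplit

open scoped BigOperators Topology Manifold Classical MeasureTheory ProbabilityTheory Matrix InnerProductSpace ComplexConjugate ContinuousMap
open Filter Set Function TopologicalSpace MeasureTheory

attribute [summit_statement] _root_.GeneralizedHardyLittlewood

/-- item stmt-Parity-31666 · crux · rank 2 · open · by planner
why it might fail: Kernel-implied by GHL, so false only with Parity; live risk = the pair constant: A must drop from 3.99 to below 3 at level 1/2 (25%), more than the twin-constant ladder 4 → 3.29956 achieved in 40 years; parity blocks only A < 2.
sources: Merikoski2020GapLimitPoints, BanksFreibergMaynard2016, arXiv:1811.03008, arXiv:1404.5094, arXiv:1510.04577, Gallagher1976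
[crux] the THREE-POINT PROPERTY of 𝓛 = primeGapLimitSet: for all reals β₀ ≤ β₁ ≤ β₂ at least one of
β₁ − β₀, β₂ − β₀, β₂ − β₁ is a limit point of (p_(n+1) − p_n)/log p_n (literal k = 3; record k = 4 =
Merikoski 2020 Thm 1 = tree named fact Merikoski2020_theorem1; k = 2 ⟺ Erdős). NECESSARY (kernel
threePoint_of_ghl = Gallagher.Ici_subset_primeGapLimitSet_of_GHL + 2 ≤ 3; threePoint_of_leaves;
threePoint_of_parity) and STRICTLY WEAKER (constrains only the closed set 𝓛: kernel content «∀ T ≥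
0, T ∈ 𝓛 ∨ 2T ∈ 𝓛»; Poisson gaps / Erdős sit strictly below uniform HL in print). ATTACKABLE with
printed method floor (arXiv:1811.03008 §1.3 + Remark 2): Maynard-weighted pair upper bound with
constant A < 3 suffices (A_rec = 3.99 by Chen's sieve; parity floor A = 2); named inputs: sharper
weighted pair upper-bound sieves (switching / Fouvry–Grupp–Wu iteration), level > 1/2 for the
modified BV over multiples of a smooth W (BFM Thm 4.2; MPZ-type), EH-level inputs (conditional; EH ⟹
k = 3 not in print). TAGS (critic row 67): WEAKER by evidence + unconditional ladder ONLY — no model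
witness in print (no hypothesis class short of HL-type input decides k = 3; EH/GEH ⟹ k = 3 NOT in
print); credit in 𝓛/A -/
@[route_item "route-Parity-GapLimitPointSplit"]
def ThreePoint : Prop :=
  Literature.NumberTheory.Sieve.HasPointProperty Literature.NumberTheory.Sieve.primeGapLimitSet 3

/-- item stmt-Parity-31667 · crux · rank 3 · open · by planner
why it might fail: Kernel-implied by GHL (its consequent is UU ∧ UL); as an implication it must produce binary Goldbach / every moving-shift HL bound from a pigeonhole fact about three gap scales — head-on CircleMethodBinary / TrueComplexityBinary; no mechanism in print.
sources: GreenTao2010, MatomakiRadziwillTao2019, MatomakiMerikoski2023, Gallagher1976, Literature.Barriers.Parity.CircleMethodBinary, Literature.Barriers.Parity.TrueComplexityBinary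
[crux] ThreePoint → (UniformUpperGivenFixed ∧ UniformLowerGivenFixed) — the record's two uniform
residual leaves stmt-Parity-26853 / 26864 (texts verbatim: Q → fixed half → uniform half of GT Conj.
1.2, upper resp. lower) weakened by exactly the face hypothesis ThreePoint. DECLARED RESIDUAL (all
binary / moving-shift content of GHL given Q and the fixed patterns; zero credit; never staffed — NO
prover time (critic row 67 P1); TERMINAL on this dial: the next rung k = 2 = Erdős is
parity-blocked); trivial branch gapLift_of_not_threePoint, contraction gapLift_iff_of_threePoint
(when ThreePoint lands the route contracts onto the record). [deps: ThreePoint] [difficulty: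
open-problem] -/
@[route_item "route-Parity-GapLimitPointSplit"]
def GapLift : Prop :=
  Literature.NumberTheory.Sieve.HasPointProperty Literature.NumberTheory.Sieve.primeGapLimitSet 3 → (((∃ η₀ : ℝ, ∃ q₀ : ℕ, ∀ (q : ℕ) [NeZero q] (χ : DirichletCharacter ℂ q) (η : ℝ), q₀ ≤ q → Literature.Barriers.Parity.IsSiegelZero χ η → η < η₀) → (∀ (d t : ℕ), 1 ≤ d → 1 ≤ t → ∀ Ψ : Fin t → Literature.NumberTheory.Sieve.AffLinForm d, Literature.NumberTheory.Sieve.IsNondegenerateSystem Ψ → ∀ ε : ℝ, 0 < ε → ∃ N₀ : ℕ, ∀ N : ℕ, N₀ ≤ N → ∀ K : Set (Fin d → ℝ), Convex ℝ K → K ⊆ Literature.NumberTheory.Sieve.realBox d N → Literature.NumberTheory.Sieve.vonMangoldtSum Ψ K N - Literature.NumberTheory.Sieve.archFactor Ψ K * Literature.NumberTheory.Sieve.singularProduct Ψ ≤ ε * (N : ℝ) ^ d) → ∀ (d t L : ℕ), 1 ≤ d → 1 ≤ t → ∀ ε : ℝ, 0 < ε → ∃ N₀ : ℕ, ∀ N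 : ℕ, N₀ ≤ N → ∀ Ψ : Fin t → Literature.NumberTheory.Sieve.AffLinForm d, Literature.NumberTheory.Sieve.IsNondegenerateSystem Ψ → Literature.NumberTheory.Sieve.affLinSize Ψ N ≤ L → ∀ K : Set (Fin d → ℝ), Convex ℝ K → K ⊆ Literature.NumberTheory.Sieve.realBox d N → Literature.NumberTheory.Sieve.vonMangoldtSum Ψ K N - Literature.NumberTheory.Sieve.archFactor Ψ K * Literature.NumberTheory.Sieve.singularProduct Ψ ≤ ε * (N : ℝ) ^ d) ∧ ((∃ η₀ : ℝ, ∃ q₀ : ℕ, ∀ (q : ℕ) [NeZero q] (χ : DirichletCharacter ℂ q) (η : ℝ), q₀ ≤ q → Literature.Barriers.Parity.IsSiegelZero χ η → η < η₀) → (∀ (d t : ℕ), 1 ≤ d → 1 ≤ t → ∀ Ψ : Fin t → Literature.NumberTheory.Sieve.AffLinForm d, Literature.NumberTheory.Sieve.IsNondegenerateSystem Ψ → ∀ ε : ℝ, 0 < ε → ∃ N₀ : ℕ, ∀ N : ℕ, N₀ ≤ N → ∀ K : Set (Fin d → ℝ), Convex ℝ K → K ⊆ Literature.NumberTheory.Sieve.realBox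 d N → Literature.NumberTheory.Sieve.archFactor Ψ K * Literature.NumberTheory.Sieve.singularProduct Ψ - Literature.NumberTheory.Sieve.vonMangoldtSum Ψ K N ≤ ε * (N : ℝ) ^ d) → ∀ (d t L : ℕ), 1 ≤ d → 1 ≤ t → ∀ ε : ℝ, 0 < ε → ∃ N₀ : ℕ, ∀ N : ℕ, N₀ ≤ N → ∀ Ψ : Fin t → Literature.NumberTheory.Sieve.AffLinForm d, Literature.NumberTheory.Sieve.IsNondegenerateSystem Ψ → Literature.NumberTheory.Sieve.affLinSize Ψ N ≤ L → ∀ K : Set (Fin d → ℝ), Convex ℝ K → K ⊆ Literature.NumberTheory.Sieve.realBox d N → Literature.NumberTheory.Sieve.archFactor Ψ K * Literature.NumberTheory.Sieve.singularProduct Ψ - Literature.NumberTheory.Sieve.vonMangoldtSum Ψ K N ≤ ε * (N : ℝ) ^ d))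

/-- item stmt-Parity-25148 · crux · rank 4 · open · by planner
why it might fail: it is the Landau–Siegel problem: no unconditional bound on η is known (Siegel's theorem is ineffective); a genuine open problem, not a lemma.
sources: HeathBrown1983PrimeTwins, MatomakiMerikoski2023, TaoTeravainen2021
[crux] Siegel zeros of primitive quadratic characters have bounded quality at all large conductors:
∃ η₀ q₀, every Siegel zero (IsSiegelZero χ η) of conductor q ≥ q₀ has η < η₀ — literally
¬UnboundedSiegelZeros (Landau–Siegel in the form the MM bridge needs). [difficulty: open-problem] ‖
TAG [crit-1 CLEARED 2026-08-30T01:46:27Z, HOME/STATUS.md l.26]: WEAKER (kernel mod MM2023 print; Q ⟹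
GHL unknown); leaf IDEA-NEEDED (Landau–Siegel) + ATTACKABLE-rung (Zhang2022 skeleton routes
PrimeLevelFamEdge/ZDegreeToeplitzBand; lens-2 T_ω ladder) + INSTRUMENTABLE (finite conductor tables,
not a rung). BC3 birth skeleton: stub_weakGoldbach (WeakHLGoldbachConj ½, open) → stub_exclusion
(MM2023 Cor 1.2 Goldbach detector + |L'| ≪ log²q, provable-now) → Q. Census
HOME/census/COSTUME-CENSUS-v1.md sha256
4afbbbc68c038369818dcc2bcc5990569ac50a4757d8938468c0838377ddd628 row WK8. -/
@[route_item "route-Parity-GapLimitPointSplit"]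
def BoundedSiegelZeroQuality : Prop :=
  ∃ η₀ : ℝ, ∃ q₀ : ℕ, ∀ (q : ℕ) [NeZero q] (χ : DirichletCharacter ℂ q) (η : ℝ), q₀ ≤ q → Literature.Barriers.Parity.IsSiegelZero χ η → η < η₀

/-- item stmt-Parity-26852 · crux · rank 5 · open · by planner
why it might fail: As a target it contains the upper prime k-tuples bound with constant 1+ε for every fixed tuple: Type-I sieves stop at factor 2 (Selberg parity, LinearSieveOptimality); record 3.2996 for twins; open even under GRH.
sources: GreenTao2010, HardyLittlewood1923, Selberg1949, Literature.Barriers.Parity.SelbergParity, Literature.Barriers.Parity.LinearSieveOptimality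
[crux; node TupleUniformitySplit (lens-5 g3, crit-1 CLEARED 2026-08-30T03:41:11Z STATUS l.116),
quantifier-order cut of UQ: the FIXED-PATTERN upper half] For every FIXED non-degenerate
affine-linear system Ψ (all d, t; quantifier order ∀Ψ ∃N₀, no size bound) and ε > 0, eventually in N
and uniformly in convex K ⊆ [−N,N]^d: Σ_{n∈K} ∏Λ(ψ_i(n)) − β_∞(Ψ,K)·∏β_p(Ψ) ≤ εN^d. OPEN CONTENT =
INFINITE complexity only (two affinely dependent forms: the k-tuple translates n+h_1,…,n+h_k and
their fibrations; d = 1 translate face = upper prime k-tuples in Λ-form, all k); finite-complexity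
systems are the Green–Tao–Ziegler THEOREM — the AP face is not progress (critic N2). WEAKER than UQ
and than the uniform upper half (kernel: necessity fixedUpper_of_ghl; Goldbach-vacuity
fixed_holds_goldbachPair — (n, c−n) satisfies it trivially, so no binary content; Siegel-INERT:
fixed-shift HL holds near exceptional scales, MatomakiMerikoski2023_fixedShift / Heath-Brown 1983 /
Tao–Teräväinen, while USZ refutes the uniform half) — hence typed BARE (record T1 logic). Leaf
BARRIER head-on (target constant 1; Type-I sieve ceiling 2 even under EH: SelbergParity,
LinearSieveOptimality); FU is ⊠-closed, so a constan -/
@[route_item "route-Parity-GapLimitPointSplit"]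
def FixedUpper : Prop :=
  ∀ (d t : ℕ), 1 ≤ d → 1 ≤ t → ∀ Ψ : Fin t → Literature.NumberTheory.Sieve.AffLinForm d, Literature.NumberTheory.Sieve.IsNondegenerateSystem Ψ → ∀ ε : ℝ, 0 < ε → ∃ N₀ : ℕ, ∀ N : ℕ, N₀ ≤ N → ∀ K : Set (Fin d → ℝ), Convex ℝ K → K ⊆ Literature.NumberTheory.Sieve.realBox d N → Literature.NumberTheory.Sieve.vonMangoldtSum Ψ K N - Literature.NumberTheory.Sieve.archFactor Ψ K * Literature.NumberTheory.Sieve.singularProduct Ψ ≤ ε * (N : ℝ) ^ d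

/-- item stmt-Parity-26863 · crux · rank 6 · open · by planner
why it might fail: As a target it contains twin primes and every prime k-tuple with the HL constant: parity (Selberg, Bombieri, Ford–Maynard; PrimePairParity even under GEH) blocks all Type-I/II routes; bounded gaps name no pattern.
sources: GreenTao2010, HardyLittlewood1923, HeathBrown1983PrimeTwins, Maynard2015SmallGaps, Literature.Barriers.Parity.PrimePairParity
[crux; node TupleUniformitySplit (lens-5 g3, crit-1 CLEARED 2026-08-30T03:41:11Z STATUS l.116),
quantifier-order cut of LQ: the FIXED-PATTERN lower half] For every FIXED non-degenerate system Ψ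
(all d, t; ∀Ψ ∃N₀) and ε > 0, eventually in N, uniformly in convex K ⊆ [−N,N]^d: β_∞(Ψ,K)·∏β_p(Ψ) −
Σ_{n∈K} ∏Λ(ψ_i(n)) ≤ εN^d. OPEN CONTENT = INFINITE complexity only (k-tuple translates and their
fibrations: twin primes, prime triples, … with the Hardy–Littlewood constant); finite complexity =
Green–Tao–Ziegler theorem (critic N2). WEAKER than LQ and than the uniform lower half (kernel
fixedLower_of_ghl; fixed_holds_goldbachPair: binary Goldbach for large even N is NOT in it;
Siegel-INERT by MatomakiMerikoski2023_fixedShift / Heath-Brown 1983 / Tao–Teräväinen) — typed BARE.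
Leaf IDEA-NEEDED + BARRIER head-on (PrimePairParity: no sieve-theoretic twin primes even under GEH;
SelbergParity); FL is ⊠-closed (no constant dial on FL, T10/N1); rung currency strictly below any
single named pattern: bounded gaps H₁ ≤ 246 (Maynard / Polymath8b; tree maynardTuple chain) = some
fixed pair pattern has infinitely many prime points; TwinLowerDensity stmt-Parity-18377. -/
@[route_item "route-Parity-GapLimitPointSplit"]
def FixedLower : Prop :=
  ∀ (d t : ℕ), 1 ≤ d → 1 ≤ t → ∀ Ψ : Fin t → Literature.NumberTheory.Sieve.AffLinForm d, Literature.NumberTheory.Sieve.IsNondegenerateSystem Ψ → ∀ ε : ℝ, 0 < ε → ∃ N₀ : ℕ, ∀ N : ℕ, N₀ ≤ N → ∀ K : Set (Fin d → ℝ), Convex ℝ K → K ⊆ Literature.NumberTheory.Sieve.realBox d N → Literature.NumberTheory.Sieve.archFactor Ψ K * Literature.NumberTheory.Sieve.singularProduct Ψ - Literature.NumberTheory.Sieve.vonMangoldtSum Ψ K N ≤ ε * (N : ℝ) ^ d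

/-- item stmt-Parity-31668 · assembly · rank 1 · closed · proved by Summit.Parity.GeneralizedHardyLittlewood.Theses.GapLimitPointSplit.assembly_proof (prover) · by planner
sources: GreenTao2010, Gallagher1976
[assembly] BoundedSiegelZeroQuality → FixedUpper → FixedLower → ThreePoint → GapLift →
GeneralizedHardyLittlewood -/
@[route_item "route-Parity-GapLimitPointSplit"]
def Assembly : Prop :=
  BoundedSiegelZeroQuality → FixedUpper → FixedLower → ThreePoint → GapLift → GeneralizedHardyLittlewood

-- `Assembly` holds: proved by `Summit.Parity.GeneralizedHardyLittlewood.Theses.GapLimitPointSplit.assembly_proof` (its module imports this route file, so no `_holds` link can be stated here).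

/-! D-0027 §2.1 — DECIDING THEOREM (planner-authored via `route open/edit --closes-file`; by planner-decomp-parity-lens-2-g7-0 2026-08-30T09:14:47Z):
its hypotheses are this route's items and its conclusion the sub-problem Statement (glue_lint), and it elaborates with this file. -/

@[closes "route-Parity-GapLimitPointSplit"] theorem closes (hQ : BoundedSiegelZeroQuality) (hFU : FixedUpper) (hFL : FixedLower)
    (hN : ThreePoint) (hR : GapLift) : GeneralizedHardyLittlewood := by
  obtain ⟨hUU, hUL⟩ := hR hN
  intro d t L hd ht ε hε
  obtain ⟨N₁, h₁⟩ := hUU hQ hFU d t L hd ht ε hε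
  obtain ⟨N₂, h₂⟩ := hUL hQ hFL d t L hd ht ε hε
  refine ⟨max N₁ N₂, fun N hN' Ψ hΨ hΨL K hK hKN => abs_sub_le_iff.mpr ⟨?_, ?_⟩⟩
  · exact h₁ N (le_trans (le_max_left _ _) hN') Ψ hΨ hΨL K hK hKN
  · exact h₂ N (le_trans (le_max_right _ _) hN') Ψ hΨ hΨL K hK hKN

end Summit.Parity.GeneralizedHardyLittlewood.Theses.GapLimitPointSplit
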